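import Literature.AlgebraicTopology.Homotopy.CountableCWDominated
import Literature.AlgebraicTopology.Homotopy.CWComplexTransfer
import Mathlib.Topology.UrysohnsLemma
import Mathlib.Topology.Algebra.Monoid
import Mathlib.Algebra.BigOperators.Finprod
import HarnessLib

/-!
# The countable CW homotopy type of an exhaustible space, from compact factorizations

Topic `Literature/AlgebraicTopology/Homotopy`, continuing `SequenceTelescope.lean`,
`SequenceTelescopeCW.lean` and `CountableCWDominated.lean` towards the discharge of Milnor's
theorem that second countable Hausdorff manifolds are dominated by — indeed homotopy
equivalent to — countable CW complexes (Milnor, *On spaces having the homotopy type of a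
CW-complex* (1959), Thm. 1 (d)⇒(b) and Cor. 1, p. 272; tree named facts
`Manifold.countable_cwDominated`, `ManifoldCWType.lean`, and
`Manifold.exists_cwComplex_homotopyEquiv`, `WhiteheadContractibleLeaves.lean`). Milnor's printed
proof is "every separable manifold is an absolute neighborhood retract" (Hanner) + "every ANR
is dominated by a countable locally finite simplicial complex" (Hanner, via the nerve of a fine
covering: Lemma 4, p. 279). The tree replaces nerves by finite lattice cube complexes around
coordinate images of COMPACT pieces (`CubeSkeletalExtension.lean`, `ChartTower.lean`,
`CompactSubsetEmbedding.lean`, `LatticeCubeComplex.lean`); this file supplies the passage from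
compact pieces to the whole (noncompact) space, which in Milnor's nerve argument is invisible
(one locally finite nerve) and here is a mapping-telescope argument (Hatcher, *Algebraic
Topology* (2002), §3.F and proof of Prop. A.11, p. 528):

* `exists_height_of_exhaustion` (PROVED): a compact exhaustion `Kⱼ ⊆ interior Kⱼ₊₁` of a
  locally compact Hausdorff space carries a continuous height `h ≥ 0` with `x ∈ K_{⌊h x⌋}`
  (Urysohn functions, a locally finite sum) — the input of `SeqTelescope.homotopyEquivExhaustion`.
* `compactSpace_of_finite_cwComplex` (PROVED): a finite CW complex is compact.
* `CompactCWFactor M K` (structure) / `HasCompactCWFactorization M` (definition, a property of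
  the space `M`): every compact `K ⊆ M` *factors up to homotopy through a finite CW complex* —
  a finite Hausdorff CW complex `P` of the universe of `M` and maps `K →ᵃ P →ᵇ M` with `b ∘ a`
  homotopic to the inclusion. `CompactCWFactor.ofULift` / `HasCompactCWFactorization.of_small`
  lift such data from complexes in `Type` (cube complexes in `ℝᴺ`) to any universe.
* `HasCompactCWFactorization.exists_countable_cwComplex_homotopyEquiv` (PROVED, GIVEN the
  cellular approximation theorem `cellularApproximation`, Hatcher Thm. 4.8, named fact of
  `CellularApproximation.lean`): a σ-compact, locally compact Hausdorff space with the
  factorization property is homotopy equivalent to a Hausdorff CW complex with countably many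
  cells. The proof builds an exhaustion `Kⱼ` adapted to chosen factorizations
  `Kⱼ →ᵃ Pⱼ →ᵇ Kⱼ₊₁` (each `Kⱼ₊₁` swallows the image of `bⱼ` and of the homotopy) and chains
  `M ≃ T(K₀ ↪ K₁ ↪ ⋯) ≃ T(bⱼaⱼ) ≃ T(aⱼ₊₁bⱼ) ≃ T(g'ⱼ)`, `g'ⱼ ≃ aⱼ₊₁bⱼ` cellular — exhaustion
  lemma, homotopy invariance, the domination swap `SeqTelescope.homotopyEquivOfFactorization`,
  homotopy invariance again, and `SeqTelescope.cwComplex` / `countable_tcell`.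
  `…_of_finite`: the same from cellular approximation for finite complexes only.
* `Manifold.exists_cwComplex_homotopyEquiv_of_hasCompactCWFactorization`,
  `Manifold.countable_cwDominated_of_hasCompactCWFactorization` (PROVED): Milnor's Cor. 1 and
  Thm. 1 (d)⇒(b) for manifolds follow from the factorization property of manifolds and cellular
  approximation (manifolds are locally compact and σ-compact).

What is deliberately NOT here: the factorization property of manifolds itself (the compact,
cube-complex half of the argument) and cellular approximation; both are consumed as
hypotheses, so nothing in this file is a named fact and nothing uses `sorry`.

## References

* J. Milnor, *On spaces having the homotopy type of a CW-complex*, Trans. Amer. Math. Soc. 90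
  (1959) 272–280: Thm. 1, Cor. 1 (p. 272), Lemma 4 and its proof (pp. 277, 279). [Milnor1959]
* A. Hatcher, *Algebraic Topology*, CUP (2002): §3.F (mapping telescopes, p. 312), proof of
  Thm. 3F.8, Appendix Prop. A.1 (p. 520), proof of Prop. A.11 (p. 528), Thm. 4.8. [HatcherAT2002]
-/

noncomputable section

open Set Topology unitInterval Function
open scoped ContinuousMap

universe u

namespace Literature.AlgebraicTopology.Homotopy

section Height

variable {M : Type u} [TopologicalSpace M] [T2Space M] [LocallyCompactSpace M]

/-- **A height function adapted to a compact exhaustion**: if `K₀ ⊆ K₁ ⊆ ⋯` are compact subsets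
of a locally compact Hausdorff space with `Kⱼ ⊆ interior Kⱼ₊₁` and `⋃ Kⱼ = M`, there is a
continuous `h : M → [0, ∞)` with `x ∈ K_{⌊h x⌋}` for every `x` — namely `h = 1 + ∑ⱼ φⱼ` with
Urysohn functions `φⱼ = 0` on `Kⱼ`, `= 1` off `interior Kⱼ₊₁` (a locally finite sum; off `Kₘ`
the first `m` summands equal `1`). This is the input `h` of the exhaustion lemma
`SeqTelescope.homotopyEquivExhaustion`. [folklore] -/
theorem exists_height_of_exhaustion (K : ℕ → Set M) (hKc : ∀ j, IsCompact (K j))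
    (hKi : ∀ j, K j ⊆ interior (K (j + 1))) (hKU : ∀ x, ∃ j, x ∈ K j) :
    ∃ h : C(M, ℝ), (∀ x, 0 ≤ h x) ∧ ∀ x, x ∈ K ⌊h x⌋₊ := by
  have hmono : ∀ {i j : ℕ}, i ≤ j → K i ⊆ K j := fun hij =>
    monotone_nat_of_le_succ (fun j => (hKi j).trans interior_subset) hij
  have hφ : ∀ j, ∃ φ : C(M, ℝ), EqOn φ 0 (K j) ∧ EqOn φ 1 (interior (K (j + 1)))ᶜ ∧
      ∀ x, φ x ∈ Icc (0 : ℝ) 1 := fun j =>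
    exists_continuous_zero_one_of_isCompact (hKc j) isOpen_interior.isClosed_compl
      (disjoint_compl_right_iff_subset.mpr (hKi j))
  choose φ hφ0 hφ1 hφI using hφ
  -- the supports of the `φ j` form a locally finite family
  have hlf : LocallyFinite fun j => support (φ j) := by
    intro x
    obtain ⟨m, hm⟩ := hKU x
    refine ⟨interior (K (m + 1)), isOpen_interior.mem_nhds (hKi m hm), ?_⟩
    refine (Set.finite_lt_nat (m + 1)).subset ?_
    rintro j ⟨y, hy, hyint⟩
    by_contra hj
    simp only [mem_setOf_eq, not_lt] at hj
    have hyK : y ∈ K j := hmono hj (interior_subset hyint)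
    exact hy (hφ0 j hyK)
  let hs : C(M, ℝ) := ⟨fun x => ∑ᶠ j, φ j x, continuous_finsum (fun j => (φ j).continuous) hlf⟩
  have hs_nonneg : ∀ x, 0 ≤ hs x := fun x => finsum_nonneg fun j => (hφI j x).1
  refine ⟨1 + hs, fun x => by simpa using add_nonneg zero_le_one (hs_nonneg x), fun x => ?_⟩
  set m := ⌊(1 + hs) x⌋₊ with hm
  by_contra hx
  -- off `K m`, the summands `φ j x`, `j < m`, are all `1`
  have hone : ∀ j < m, φ j x = 1 := fun j hj => by
    refine hφ1 j fun hxint => hx ?_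
    exact hmono (Nat.succ_le_of_lt hj) (interior_subset hxint)
  have hfin : (support fun j => φ j x).Finite := hlf.point_finite x
  have hsum : hs x = ∑ j ∈ hfin.toFinset, φ j x := by
    show ∑ᶠ j, φ j x = _
    exact finsum_eq_sum_of_support_subset _ (by simp)
  have hsub : Finset.range m ⊆ hfin.toFinset := fun j hj => by
    rw [Finite.mem_toFinset, mem_support, hone j (Finset.mem_range.1 hj)]
    exact one_ne_zero
  have hle : (m : ℝ) ≤ hs x := by
    calc (m : ℝ) = ∑ j ∈ Finset.range m, φ j x := by
          rw [Finset.sum_congr rfl fun j hj => hone j (Finset.mem_range.1 hj)]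
          simp
      _ ≤ ∑ j ∈ hfin.toFinset, φ j x :=
          Finset.sum_le_sum_of_subset_of_nonneg hsub fun j _ _ => (hφI j x).1
      _ = hs x := hsum.symm
  have hlt : (1 + hs) x < m + 1 := Nat.lt_floor_add_one ((1 + hs) x)
  have : (1 + hs) x = 1 + hs x := rfl
  linarith

end Height

/-! ### Finite CW complexes are compact -/

/-- **A finite CW complex is compact** (Hatcher 2002, p. 520: a finite union of closed cells,
each compact). Mathlib (pinned) has `RelCWComplex.isCompact_closedCell` but not this
consequence. [cite: HatcherAT2002, Prop. A.1 (discussion, p. 520)] -/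
theorem compactSpace_of_finite_cwComplex (P : Type*) [TopologicalSpace P]
    [CWComplex (univ : Set P)] [RelCWComplex.Finite (univ : Set P)] : CompactSpace P := by
  haveI := RelCWComplex.finite_cells_of_finite (C := (univ : Set P))
  refine ⟨?_⟩
  have hU : (⋃ p : Σ n, RelCWComplex.cell (univ : Set P) n,
      RelCWComplex.closedCell (C := (univ : Set P)) p.1 p.2) = univ := by
    rw [Set.iUnion_sigma]
    exact CWComplex.union (C := (univ : Set P))
  rw [← hU]
  exact isCompact_iUnion fun p => RelCWComplex.isCompact_closedCell

/-! ### Factorizations of compact subsets through finite CW complexes -/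

section Factor

variable {M : Type u} [TopologicalSpace M]

/-- **A factorization of a compact subset `K ⊆ M` through a finite CW complex, up to homotopy**:
a Hausdorff space `P` (same universe as `M`) with a finite classical CW structure, maps
`a : K → P`, `b : P → M` and a homotopy from `b ∘ a` to the inclusion `K ↪ M`. (The data that
Milnor's / Hanner's domination arguments produce on a compact piece of a manifold: `a` = the
map to the nerve, resp. to a cube complex around the image of a coordinate embedding, `b` = the
skeleton-wise extension; Milnor 1959, proof of Lemma 4, p. 279.) [folklore] -/
structure CompactCWFactor (M : Type u) [TopologicalSpace M] (K : Set M) where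
  /-- the finite CW complex -/
  P : Type u
  /-- its topology -/
  [topP : TopologicalSpace P]
  /-- it is Hausdorff -/
  [t2P : T2Space P]
  /-- its classical CW structure -/
  [cwP : CWComplex (univ : Set P)]
  /-- the CW structure is finite -/
  finP : RelCWComplex.Finite (univ : Set P)
  /-- the map into the complex -/
  a : C(K, P)
  /-- the map back to the space -/
  b : C(P, M)
  /-- `b ∘ a` is homotopic to the inclusion `K ↪ M` -/
  hom : (b.comp a).Homotopy ⟨(Subtype.val : K → M), continuous_subtype_val⟩

namespace CompactCWFactor

/-- The topology of the complex of a factorization. [folklore] -/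
instance instTopologicalSpaceP {K : Set M} (F : CompactCWFactor M K) : TopologicalSpace F.P :=
  F.topP

/-- The complex of a factorization is Hausdorff. [folklore] -/
instance instT2SpaceP {K : Set M} (F : CompactCWFactor M K) : T2Space F.P := F.t2P

/-- The CW structure of the complex of a factorization. [folklore] -/
instance instCWComplexP {K : Set M} (F : CompactCWFactor M K) : CWComplex (univ : Set F.P) :=
  F.cwP

end CompactCWFactor

/-- **Every compact subset factors through a finite CW complex up to homotopy** (a property of
the space `M`): for every compact `K ⊆ M` there are a Hausdorff space `P` of the universe of `M`
with a finite classical CW structure and maps `a : K → P`, `b : P → M` with `b ∘ a` homotopic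
to the inclusion `K ↪ M`. ANRs have this property (Hanner 1951 / Milnor 1959, Thm. 1 (d)⇒(b),
whose proof via Lemma 4, p. 279, factors the identity of the whole space through a nerve); for
topological manifolds it is the compact case of that argument with cube complexes (Hatcher
2002, Cor. A.8–A.9). It is the hypothesis under which the exhaustion argument below produces a
countable CW homotopy type. [folklore] -/
def HasCompactCWFactorization (M : Type u) [TopologicalSpace M] : Prop :=
  ∀ K : Set M, IsCompact K →
    ∃ (P : Type u) (_ : TopologicalSpace P) (_ : T2Space P) (_ : CWComplex (univ : Set P)),
      RelCWComplex.Finite (univ : Set P) ∧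
      ∃ (a : C(↥K, P)) (b : C(P, M)),
        (b.comp a).Homotopic ⟨(Subtype.val : K → M), continuous_subtype_val⟩

/-- Unfolding of `HasCompactCWFactorization`. [folklore] -/
theorem hasCompactCWFactorization_iff (M : Type u) [TopologicalSpace M] :
    HasCompactCWFactorization M ↔ ∀ K : Set M, IsCompact K →
      ∃ (P : Type u) (_ : TopologicalSpace P) (_ : T2Space P) (_ : CWComplex (univ : Set P)),
        RelCWComplex.Finite (univ : Set P) ∧
        ∃ (a : C(↥K, P)) (b : C(P, M)),
          (b.comp a).Homotopic ⟨(Subtype.val : K → M), continuous_subtype_val⟩ :=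
  Iff.rfl

namespace CompactCWFactor

variable {K : Set M} (F : CompactCWFactor M K)

/-- The points of `M` reached by the factorization: the image of `b` and of the homotopy.
[folklore] -/
def reach : Set M := range F.b ∪ range F.hom

/-- The image of `b` is reached. [folklore] -/
theorem range_b_subset_reach : range F.b ⊆ F.reach := subset_union_left

/-- Every value of the homotopy is reached. [folklore] -/
theorem hom_mem_reach (p : I × K) : F.hom p ∈ F.reach := Or.inr ⟨p, rfl⟩

/-- For compact `K` the reached set is compact (a finite CW complex is compact). [folklore] -/
theorem isCompact_reach (hK : IsCompact K) : IsCompact F.reach := by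
  haveI : CompactSpace K := isCompact_iff_compactSpace.mp hK
  haveI : RelCWComplex.Finite (univ : Set F.P) := F.finP
  haveI : CompactSpace F.P := compactSpace_of_finite_cwComplex F.P
  exact (isCompact_range F.b.continuous).union (isCompact_range F.hom.continuous)

end CompactCWFactor

/-! ### Lifting concrete factorizations (complexes in `Type`, e.g. cube complexes in `ℝᴺ`) -/

/-- **Factorization data through a finite CW complex living in `Type`** (such as a finite
lattice cube complex `↥P`, `P ⊆ ℝᴺ`, `Literature.Topology.Euclidean.exists_cwComplex_nbhd_of_isCompact`)
give a `CompactCWFactor M K` for `M` in any universe: the complex is replaced by its copy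
`ULift P₀` in the universe of `M`, with the CW structure transported along
`P₀ ≃ₜ ULift P₀` (`CWTransfer.ofHomeomorph`, `CWTransfer.finite_ofHomeomorph`), and the maps and
the homotopy are composed with `ULift.up` / `ULift.down`. [folklore] -/
def CompactCWFactor.ofULift {K : Set M} (P₀ : Type) [TopologicalSpace P₀] [T2Space P₀]
    [CWComplex (univ : Set P₀)] [RelCWComplex.Finite (univ : Set P₀)] (a : C(↥K, P₀))
    (b : C(P₀, M)) (H : (b.comp a).Homotopy ⟨(Subtype.val : K → M), continuous_subtype_val⟩) :
    CompactCWFactor M K :=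
  letI : CWComplex (univ : Set (ULift.{u} P₀)) :=
    CWTransfer.ofHomeomorph.{0, u} (C := (univ : Set P₀))
      ((Homeomorph.Set.univ P₀).trans Homeomorph.ulift.symm)
  { P := ULift.{u} P₀
    finP := CWTransfer.finite_ofHomeomorph.{0, u} (C := (univ : Set P₀))
      ((Homeomorph.Set.univ P₀).trans Homeomorph.ulift.symm)
    a := ⟨fun x => ULift.up (a x), continuous_uliftUp.comp a.continuous⟩
    b := ⟨fun y => b y.down, b.continuous.comp continuous_uliftDown⟩
    hom :=
      { toFun := fun p => H p
        continuous_toFun := H.continuous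
        map_zero_left := fun x => H.apply_zero x
        map_one_left := fun x => H.apply_one x } }

/-- **The factorization property from complexes in `Type`**: to verify
`HasCompactCWFactorization M` it suffices to factor each compact `K ⊆ M`, up to homotopy,
through a finite Hausdorff CW complex `P₀ : Type` (e.g. a finite lattice cube complex in `ℝᴺ`),
whatever the universe of `M` (`CompactCWFactor.ofULift`). [folklore] -/
theorem HasCompactCWFactorization.of_small
    (h : ∀ K : Set M, IsCompact K →
      ∃ (P₀ : Type) (_ : TopologicalSpace P₀) (_ : T2Space P₀) (_ : CWComplex (univ : Set P₀)),
        RelCWComplex.Finite (univ : Set P₀) ∧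
        ∃ (a : C(↥K, P₀)) (b : C(P₀, M)),
          (b.comp a).Homotopic ⟨(Subtype.val : K → M), continuous_subtype_val⟩) :
    HasCompactCWFactorization M := fun K hK => by
  obtain ⟨P₀, _, _, _, hfin, a, b, hab⟩ := h K hK
  haveI := hfin
  let F := CompactCWFactor.ofULift (M := M) P₀ a b hab.some
  exact ⟨F.P, F.topP, F.t2P, F.cwP, F.finP, F.a, F.b, ⟨F.hom⟩⟩

namespace HasCompactCWFactorization

/-- A space with the factorization property has factorization *data* for each compact subset.
[folklore] -/
theorem nonempty_factor (hM : HasCompactCWFactorization M) {K : Set M} (hK : IsCompact K) :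
    Nonempty (CompactCWFactor M K) := by
  obtain ⟨P, _, _, _, hfin, a, b, hab⟩ := hM K hK
  exact ⟨{ P := P, finP := hfin, a := a, b := b, hom := hab.some }⟩

/-- A chosen factorization of each compact subset. [folklore] -/
def factor (hM : HasCompactCWFactorization M) (K : {K : Set M // IsCompact K}) :
    CompactCWFactor M K.1 :=
  (hM.nonempty_factor K.2).some

/-! ### The adapted compact exhaustion -/

section Step

variable [LocallyCompactSpace M] (hM : HasCompactCWFactorization M)

/-- One step of the exhaustion: a compact set whose interior contains `K`, the given compact `L`
and everything reached by the chosen factorization of `K`. [folklore] -/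
def step (K : {K : Set M // IsCompact K}) (L : Set M) (hL : IsCompact L) :
    {K' : Set M // IsCompact K'} :=
  ⟨Classical.choose (exists_compact_superset
      ((K.2.union hL).union ((hM.factor K).isCompact_reach K.2))),
    (Classical.choose_spec (exists_compact_superset
      ((K.2.union hL).union ((hM.factor K).isCompact_reach K.2)))).1⟩

/-- The defining property of `step`. [folklore] -/
theorem step_spec (K : {K : Set M // IsCompact K}) (L : Set M) (hL : IsCompact L) :
    K.1 ∪ L ∪ (hM.factor K).reach ⊆ interior (hM.step K L hL).1 :=
  (Classical.choose_spec (exists_compact_superset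
    ((K.2.union hL).union ((hM.factor K).isCompact_reach K.2)))).2

end Step

section Exhaustion

variable [LocallyCompactSpace M] [SigmaCompactSpace M] (hM : HasCompactCWFactorization M)

/-- **The adapted exhaustion** `K₀ ⊆ K₁ ⊆ ⋯`: compact sets, each containing in its interior the
previous one, the corresponding member of a compact exhaustion of `M`, and everything reached
by the chosen factorization of the previous one. [folklore] -/
def exh : ℕ → {K : Set M // IsCompact K}
  | 0 => ⟨CompactExhaustion.choice M 0, (CompactExhaustion.choice M).isCompact 0⟩
  | j + 1 => hM.step (exh j) (CompactExhaustion.choice M (j + 1))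
      ((CompactExhaustion.choice M).isCompact (j + 1))

/-- The base of the exhaustion. [folklore] -/
theorem exh_zero : (hM.exh 0).1 = CompactExhaustion.choice M 0 := rfl

/-- The recursion of the exhaustion. [folklore] -/
theorem exh_succ (j : ℕ) : hM.exh (j + 1) = hM.step (hM.exh j) (CompactExhaustion.choice M (j + 1))
    ((CompactExhaustion.choice M).isCompact (j + 1)) := rfl

/-- The sets of the adapted exhaustion. [folklore] -/
def Kset (j : ℕ) : Set M := (hM.exh j).1

/-- They are compact. [folklore] -/
theorem isCompact_Kset (j : ℕ) : IsCompact (hM.Kset j) := (hM.exh j).2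

/-- The chosen factorization of the `j`-th set. [folklore] -/
abbrev fac (j : ℕ) : CompactCWFactor M (hM.Kset j) := hM.factor (hM.exh j)

/-- The defining inclusion of the exhaustion. [folklore] -/
theorem subset_interior_Kset_succ (j : ℕ) :
    hM.Kset j ∪ CompactExhaustion.choice M (j + 1) ∪ (hM.fac j).reach ⊆
      interior (hM.Kset (j + 1)) := by
  show (hM.exh j).1 ∪ _ ∪ (hM.factor (hM.exh j)).reach ⊆ interior (hM.exh (j + 1)).1
  rw [exh_succ]
  exact hM.step_spec _ _ _

/-- Each set lies in the interior of the next. [folklore] -/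
theorem Kset_subset_interior (j : ℕ) : hM.Kset j ⊆ interior (hM.Kset (j + 1)) :=
  (subset_union_left.trans subset_union_left).trans (hM.subset_interior_Kset_succ j)

/-- The adapted exhaustion is increasing. [folklore] -/
theorem Kset_mono (j : ℕ) : hM.Kset j ⊆ hM.Kset (j + 1) :=
  (hM.Kset_subset_interior j).trans interior_subset

/-- It dominates the standard compact exhaustion of `M`. [folklore] -/
theorem compactExhaustion_subset_Kset (j : ℕ) : CompactExhaustion.choice M j ⊆ hM.Kset j := by
  cases j with
  | zero =>
    show _ ⊆ (hM.exh 0).1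
    rw [exh_zero]
  | succ j =>
    exact (subset_union_right.trans subset_union_left).trans
      ((hM.subset_interior_Kset_succ j).trans interior_subset)

/-- Hence it covers `M`. [folklore] -/
theorem exists_mem_Kset (x : M) : ∃ j, x ∈ hM.Kset j :=
  let ⟨j, hj⟩ := (CompactExhaustion.choice M).exists_mem x
  ⟨j, hM.compactExhaustion_subset_Kset j hj⟩

/-- Everything reached by the `j`-th factorization lies in the `(j+1)`-st set. [folklore] -/
theorem reach_subset_Kset (j : ℕ) : (hM.fac j).reach ⊆ hM.Kset (j + 1) :=
  subset_union_right.trans ((hM.subset_interior_Kset_succ j).trans interior_subset)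

/-! ### The two interleaved telescopes -/

/-- The finite CW complexes `Pⱼ` of the factorizations. [folklore] -/
abbrev Ps (j : ℕ) : Type u := (hM.fac j).P

/-- `aⱼ : Kⱼ → Pⱼ`. [folklore] -/
def aMap (j : ℕ) : C(↥(hM.Kset j), hM.Ps j) := (hM.fac j).a

/-- `bⱼ : Pⱼ → Kⱼ₊₁` (the map back, which lands in the next set). [folklore] -/
def bMap (j : ℕ) : C(hM.Ps j, ↥(hM.Kset (j + 1))) :=
  ⟨fun y => ⟨(hM.fac j).b y, hM.reach_subset_Kset j ((hM.fac j).range_b_subset_reach ⟨y, rfl⟩)⟩,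
    (hM.fac j).b.continuous.subtype_mk _⟩

/-- `fⱼ = bⱼ ∘ aⱼ : Kⱼ → Kⱼ₊₁`. [folklore] -/
def fMap (j : ℕ) : C(↥(hM.Kset j), ↥(hM.Kset (j + 1))) := (hM.bMap j).comp (hM.aMap j)

/-- `gⱼ = aⱼ₊₁ ∘ bⱼ : Pⱼ → Pⱼ₊₁`. [folklore] -/
def gMap (j : ℕ) : C(hM.Ps j, hM.Ps (j + 1)) := (hM.aMap (j + 1)).comp (hM.bMap j)

/-- `fⱼ` is homotopic, inside `Kⱼ₊₁`, to the inclusion `Kⱼ ↪ Kⱼ₊₁` (the homotopy of the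
factorization, which takes values in `Kⱼ₊₁` by construction of the exhaustion). [folklore] -/
def fHomotopy (j : ℕ) :
    (hM.fMap j).Homotopy (SeqTelescope.inclSeq hM.Kset hM.Kset_mono j) where
  toFun p := ⟨(hM.fac j).hom p, hM.reach_subset_Kset j ((hM.fac j).hom_mem_reach p)⟩
  continuous_toFun := (hM.fac j).hom.continuous.subtype_mk _
  map_zero_left x := Subtype.ext ((hM.fac j).hom.apply_zero x)
  map_one_left x := Subtype.ext ((hM.fac j).hom.apply_one x)

include hM in
/-- **A σ-compact, locally compact Hausdorff space whose compact subsets factor through finite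
CW complexes up to homotopy has the homotopy type of a countable CW complex**, GIVEN the
cellular approximation theorem (`hCA`, Hatcher Thm. 4.8). Proof (Milnor 1959, Cor. 1, organised
as in Hatcher 2002, proof of Prop. A.11 and of Thm. 3F.8): with the adapted exhaustion `Kⱼ` and
a height function, `M ≃ T(K₀ ↪ K₁ ↪ ⋯)` (`SeqTelescope.homotopyEquivExhaustion`)
`≃ T(b₀a₀, b₁a₁, …)` (homotopic bonding maps) `≃ T(a₁b₀, a₂b₁, …)` (the domination swap
`SeqTelescope.homotopyEquivOfFactorization`) `≃ T(g'₀, g'₁, …)` with `g'ⱼ ≃ aⱼ₊₁bⱼ` cellular,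
and the last telescope is a Hausdorff CW complex with countably many cells
(`SeqTelescope.cwComplex`, `SeqTelescope.countable_tcell`). [cite: Milnor1959, Thm. 1 and Cor. 1 (p. 272)] -/
theorem exists_countable_cwComplex_homotopyEquiv [T2Space M] (hCA : cellularApproximation.{u, u}) :
    ∃ (C : Type u) (_ : TopologicalSpace C) (_ : T2Space C) (_ : CWComplex (univ : Set C)),
      Countable (Σ k, RelCWComplex.cell (univ : Set C) k) ∧ Nonempty (M ≃ₕ C) := by
  choose g' hg' hgg' using fun j => hCA (hM.Ps j) (hM.Ps (j + 1)) (hM.gMap j)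
  obtain ⟨h, h0, hh⟩ := exists_height_of_exhaustion hM.Kset hM.isCompact_Kset
    hM.Kset_subset_interior hM.exists_mem_Kset
  letI inst : CWComplex (univ : Set (SeqTelescope (X := hM.Ps) g')) :=
    SeqTelescope.cwComplex (X := hM.Ps) g' hg'
  refine ⟨SeqTelescope (X := hM.Ps) g', inferInstance, inferInstance, inst, ?_, ⟨?_⟩⟩
  · refine SeqTelescope.countable_tcell (X := hM.Ps) fun n => ?_
    haveI : RelCWComplex.Finite (univ : Set (hM.Ps n)) := (hM.fac n).finP
    haveI := RelCWComplex.finite_cells_of_finite (C := (univ : Set (hM.Ps n)))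
    infer_instance
  · have e1 : M ≃ₕ SeqTelescope (SeqTelescope.inclSeq hM.Kset hM.Kset_mono) :=
      (SeqTelescope.homotopyEquivExhaustion hM.Kset hM.Kset_mono h h0 hh
        fun j => (hM.isCompact_Kset j).isClosed).symm
    have e2 : SeqTelescope (SeqTelescope.inclSeq hM.Kset hM.Kset_mono) ≃ₕ SeqTelescope hM.fMap :=
      SeqTelescope.homotopyEquivOfHomotopy (f := SeqTelescope.inclSeq hM.Kset hM.Kset_mono)
        (f' := hM.fMap) fun j => (hM.fHomotopy j).symm
    have e3 : SeqTelescope hM.fMap ≃ₕ SeqTelescope hM.gMap :=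
      SeqTelescope.homotopyEquivOfFactorization (X := fun j => ↥(hM.Kset j)) (Y := hM.Ps)
        hM.fMap hM.gMap hM.aMap hM.bMap (fun _ _ => rfl) (fun _ _ => rfl)
    have e4 : SeqTelescope hM.gMap ≃ₕ SeqTelescope (X := hM.Ps) g' :=
      SeqTelescope.homotopyEquivOfHomotopy (f := hM.gMap) (f' := g') fun j => (hgg' j).some
    exact ((e1.trans e2).trans e3).trans e4

include hM in
/-- **The same conclusion from cellular approximation for FINITE complexes only.** The
complexes `Pⱼ` of the factorizations are finite, so the telescope argument of
`exists_countable_cwComplex_homotopyEquiv` needs Hatcher's Thm. 4.8 only for maps between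
finite Hausdorff CW complexes; this version takes exactly that as its hypothesis `hCA` (stated
inline: for finite `X`, `Y` every `f : C(X, Y)` is homotopic to a cellular map), so that a
discharge of the finite case of the cellular approximation theorem already yields the countable
CW homotopy type. Same proof. [cite: Milnor1959, Thm. 1 and Cor. 1 (p. 272)] -/
theorem exists_countable_cwComplex_homotopyEquiv_of_finite [T2Space M]
    (hCA : ∀ (X Y : Type u) [TopologicalSpace X] [T2Space X] [CWComplex (univ : Set X)]
      [TopologicalSpace Y] [T2Space Y] [CWComplex (univ : Set Y)],
      RelCWComplex.Finite (univ : Set X) → RelCWComplex.Finite (univ : Set Y) →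
      ∀ f : C(X, Y), ∃ g : C(X, Y), IsCellularMap g ∧ f.Homotopic g) :
    ∃ (C : Type u) (_ : TopologicalSpace C) (_ : T2Space C) (_ : CWComplex (univ : Set C)),
      Countable (Σ k, RelCWComplex.cell (univ : Set C) k) ∧ Nonempty (M ≃ₕ C) := by
  choose g' hg' hgg' using fun j =>
    hCA (hM.Ps j) (hM.Ps (j + 1)) (hM.fac j).finP (hM.fac (j + 1)).finP (hM.gMap j)
  obtain ⟨h, h0, hh⟩ := exists_height_of_exhaustion hM.Kset hM.isCompact_Kset
    hM.Kset_subset_interior hM.exists_mem_Kset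
  letI inst : CWComplex (univ : Set (SeqTelescope (X := hM.Ps) g')) :=
    SeqTelescope.cwComplex (X := hM.Ps) g' hg'
  refine ⟨SeqTelescope (X := hM.Ps) g', inferInstance, inferInstance, inst, ?_, ⟨?_⟩⟩
  · refine SeqTelescope.countable_tcell (X := hM.Ps) fun n => ?_
    haveI : RelCWComplex.Finite (univ : Set (hM.Ps n)) := (hM.fac n).finP
    haveI := RelCWComplex.finite_cells_of_finite (C := (univ : Set (hM.Ps n)))
    infer_instance
  · have e1 : M ≃ₕ SeqTelescope (SeqTelescope.inclSeq hM.Kset hM.Kset_mono) :=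
      (SeqTelescope.homotopyEquivExhaustion hM.Kset hM.Kset_mono h h0 hh
        fun j => (hM.isCompact_Kset j).isClosed).symm
    have e2 : SeqTelescope (SeqTelescope.inclSeq hM.Kset hM.Kset_mono) ≃ₕ SeqTelescope hM.fMap :=
      SeqTelescope.homotopyEquivOfHomotopy (f := SeqTelescope.inclSeq hM.Kset hM.Kset_mono)
        (f' := hM.fMap) fun j => (hM.fHomotopy j).symm
    have e3 : SeqTelescope hM.fMap ≃ₕ SeqTelescope hM.gMap :=
      SeqTelescope.homotopyEquivOfFactorization (X := fun j => ↥(hM.Kset j)) (Y := hM.Ps)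
        hM.fMap hM.gMap hM.aMap hM.bMap (fun _ _ => rfl) (fun _ _ => rfl)
    have e4 : SeqTelescope hM.gMap ≃ₕ SeqTelescope (X := hM.Ps) g' :=
      SeqTelescope.homotopyEquivOfHomotopy (f := hM.gMap) (f' := g') fun j => (hgg' j).some
    exact ((e1.trans e2).trans e3).trans e4

end Exhaustion

end HasCompactCWFactorization

end Factor

/-! ### Manifolds: Milnor's Corollary 1 and Theorem 1 (d)⇒(b), given the compact factorization -/

/-- **Milnor 1959, Cor. 1, reduced to the compact factorization and cellular approximation**:
if every Hausdorff second countable topological `n`-manifold has the compact factorization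
property (`HasCompactCWFactorization`; the content of Hanner's Thm. 3.3 + 6.1 / Hatcher's
Cor. A.8–A.9 on compact pieces) then, GIVEN cellular approximation (`hCA`), every such manifold
has the homotopy type of a countable CW complex (the tree's named fact
`Manifold.exists_cwComplex_homotopyEquiv`): such a manifold is locally compact
(`ChartedSpace.locallyCompactSpace`) and σ-compact, so the exhaustion theorem applies.
[cite: Milnor1959, Cor. 1 (p. 272)] -/
theorem Manifold.exists_cwComplex_homotopyEquiv_of_hasCompactCWFactorization
    (hCA : cellularApproximation.{u, u})
    (hfac : ∀ (n : ℕ) (M : Type u) [TopologicalSpace M] [T2Space M] [SecondCountableTopology M]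
      [ChartedSpace (EuclideanSpace ℝ (Fin n)) M], HasCompactCWFactorization M) :
    Manifold.exists_cwComplex_homotopyEquiv.{u} := by
  intro n M _ _ _ _
  haveI : LocallyCompactSpace M := ChartedSpace.locallyCompactSpace (EuclideanSpace ℝ (Fin n)) M
  exact HasCompactCWFactorization.exists_countable_cwComplex_homotopyEquiv (hfac n M) hCA

/-- **Milnor 1959, Thm. 1 (d)⇒(b) for manifolds, reduced likewise**: under the same two
hypotheses every Hausdorff second countable topological `n`-manifold is dominated by a
countable CW complex (the named fact `Manifold.countable_cwDominated` of `ManifoldCWType.lean`),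
a homotopy equivalence being in particular a domination
(`Manifold.countable_cwDominated_of_exists_cwComplex_homotopyEquiv`).
[cite: Milnor1959, Thm. 1 (d)⇒(b) and Cor. 1 (pp. 272–273)] -/
theorem Manifold.countable_cwDominated_of_hasCompactCWFactorization
    (hCA : cellularApproximation.{u, u})
    (hfac : ∀ (n : ℕ) (M : Type u) [TopologicalSpace M] [T2Space M] [SecondCountableTopology M]
      [ChartedSpace (EuclideanSpace ℝ (Fin n)) M], HasCompactCWFactorization M) :
    Manifold.countable_cwDominated.{u} :=
  Manifold.countable_cwDominated_of_exists_cwComplex_homotopyEquiv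
    (Manifold.exists_cwComplex_homotopyEquiv_of_hasCompactCWFactorization hCA hfac)

end Literature.AlgebraicTopology.Homotopy

end
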